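import Summits.HodgeConjecture.HodgeConjecture.Theses.RankFourFaces
import Summits.HodgeConjecture.HodgeConjecture.Theorems.PadicSemiregularLiftHodgeBeyondAnchorsUnconditional
import Summits.HodgeConjecture.HodgeConjecture.Theorems.HodgeBeyondAnchors.Negative.FalseWithoutIsSmoothProjective

/-!
# `RankFourFaces.AbelianComplement` is summit-equivalent; which hypothesis is load-bearing

Refuter lane `Theorems/AbelianComplement/Negative/` for the crux
`Summit.HodgeConjecture.HodgeConjecture.Theses.RankFourFaces.AbelianComplement`
(stmt-HodgeConjecture-15889, route `RankFourFaces`, rank 9: the Hodge conjecture for every smooth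
projective complex `n`-fold `X` that is not `A.X` for an abelian variety `A` with `A.dim = n`).
No Theses declaration is refuted here (the item is the Clay statement up to equivalence, so an
honest refutation is a counterexample to the Hodge conjecture); what is certified is:

* `abelianComplement_iff_hodgeConjecture` — **restates the summit**: `AbelianComplement ↔ HodgeConjecture`,
  kernel-checked with no residual hypothesis. `←` is restriction; `→` drops into the sibling crux
  `PadicSemiregularLift.HodgeBeyondAnchors` (same statement with an extra Fermat exclusion) and applies the
  tree's `hodgeConjecture_of_hodgeBeyondAnchors_holds` (every smooth projective `X` is dominated by the
  non-abelian `(X × ℙ¹) × ℙ¹`, and `HC` descends along the two projections).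
* `abelianComplement_iff_without_exclusion` — hence the abelian-exclusion hypothesis
  `∀ A, A.dim = n → A.X ≠ X` is logically IDLE: with or without it the statement is the summit. The
  route's case split in `closes` (abelian `X` via `CMToAbelian`, the rest via this item) is cosmetic —
  the last hypothesis of `Assembly` alone already carries `HodgeConjecture`
  (`hodgeConjecture_of_abelianComplement`).
* `abelianComplement_hypotheses_satisfiable` — non-vacuity: `(ℙ¹ × ℙ¹) × ℙ¹` is a smooth projective
  threefold that is not `A.X` for any abelian variety (abelian varieties contain no rational curves,
  Milne 1986 §3 Cor. 3.8, discharged in the tree).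
* `abelianComplement_false_without_isSmoothProjective`, `abelianComplement_false_with_decoupled_index` —
  the hypothesis `IsSmoothProjective n X` is load-bearing FOR THE TYPING: the point `Spec ℂ` read with
  index `n = 1` satisfies the abelian exclusion (`schemeDim = 0 ≠ 1`) and fails `HodgeConjectureFor 1`
  through the anti-vacuity conjunct `Nonempty (HodgeModel 1 _)` (sibling lemmas
  `not_hodgeConjectureFor_unit`, `abelianVariety_X_ne_unit`).
* `abelianComplement_dim_zero` — the degenerate slice `n = 0` holds outright (extreme codimension).

References: P. Deligne, *The Hodge conjecture* (Clay, 2000), §1; J.S. Milne, *Abelian Varieties* (1986),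
§3 Cor. 3.8; C. Voisin, *Hodge Theory and Complex Algebraic Geometry I* (2002), §7.3.2, §11.3.
-/

-- Summit.HodgeConjecture.HodgeConjecture.… repeats the summit name by the D-0017 layout (Sub = Summit).
set_option linter.dupNamespace false

noncomputable section

open CategoryTheory AlgebraicGeometry MonoidalCategory
open Literature.AlgebraicGeometry.Motives Literature.AlgebraicGeometry.HodgeTheory
open Summit.HodgeConjecture.HodgeConjecture.Theses.RankFourFaces
open Summit.HodgeConjecture.HodgeConjecture.Theorems.HodgeBeyondAnchors
open Summit.HodgeConjecture.HodgeConjecture.Theorems.HodgeBeyondAnchors.Negative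

namespace Summit.HodgeConjecture.HodgeConjecture.Theorems.AbelianComplement.Negative

/-- **The crux implies the summit.** `AbelianComplement → HodgeConjecture`: forget the Fermat exclusion
of `PadicSemiregularLift.HodgeBeyondAnchors` and apply the tree's unconditional
`hodgeConjecture_of_hodgeBeyondAnchors_holds` (double `ℙ¹`-product trick).
[cite: Deligne2000, §1] [cite: Milne1986AbelianVarieties, §3 Cor. 3.8 (p. 107)] -/
theorem hodgeConjecture_of_abelianComplement (h : AbelianComplement) : _root_.HodgeConjecture :=
  hodgeConjecture_of_hodgeBeyondAnchors_holds fun _ _ hX hA _ ↦ h hX hA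

/-- **`AbelianComplement ↔ HodgeConjecture`, unconditionally** (`←` is the restriction of the summit to
the non-abelian locus). The item restates the summit. [cite: Deligne2000, §1] -/
theorem abelianComplement_iff_hodgeConjecture : AbelianComplement ↔ _root_.HodgeConjecture :=
  ⟨hodgeConjecture_of_abelianComplement, fun H _ _ hX _ ↦ H hX⟩

/-- **The abelian exclusion is idle.** Dropping the hypothesis `∀ A, A.dim = n → A.X ≠ X` gives
literally the summit, to which the item is equivalent; so the hypothesis separates nothing.
[cite: Deligne2000, §1] -/
theorem abelianComplement_iff_without_exclusion :
    AbelianComplement ↔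
      ∀ ⦃n : ℕ⦄ ⦃X : SchemeOver ℂ⦄, IsSmoothProjective n X → HodgeConjectureFor n X :=
  abelianComplement_iff_hodgeConjecture

/-- **Non-vacuity.** The hypotheses of the item are jointly satisfiable: `(ℙ¹ × ℙ¹) × ℙ¹` is a smooth
projective threefold and is not `A.X` for any abelian variety `A` (it contains rational curves).
[cite: Milne1986AbelianVarieties, §3 Cor. 3.8 (p. 107)] -/
theorem abelianComplement_hypotheses_satisfiable :
    ∃ (n : ℕ) (X : SchemeOver ℂ), IsSmoothProjective n X ∧
      ∀ A : AbelianVariety ℂ, A.dim = n → A.X ≠ X := by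
  have hL : IsSmoothProjective 1 (projectiveSpace 1 ℂ) := isSmoothProjective_projectiveSpace_holds ℂ 1
  exact ⟨1 + 1 + 1, (projectiveSpace 1 ℂ ⊗ projectiveSpace 1 ℂ) ⊗ projectiveSpace 1 ℂ,
    IsSmoothProjective.tensor_holds (IsSmoothProjective.tensor_holds hL hL) hL, fun A _ ↦
      abelianVariety_X_ne_tensor_tensor Milne1986_projectiveLine_to_abelianVariety_const_holds.{0} hL A⟩

/-- **`IsSmoothProjective` is load-bearing (for the typing).** Dropping it from the item gives a FALSE
statement: the point `Spec ℂ` read in dimension `1` satisfies the abelian exclusion and fails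
`HodgeConjectureFor 1` through the anti-vacuity conjunct. [folklore] -/
theorem abelianComplement_false_without_isSmoothProjective :
    ¬ ∀ ⦃n : ℕ⦄ ⦃X : SchemeOver ℂ⦄,
      (∀ A : AbelianVariety ℂ, A.dim = n → A.X ≠ X) → HodgeConjectureFor n X :=
  fun h ↦ not_hodgeConjectureFor_unit le_rfl (h (abelianVariety_X_ne_unit le_rfl))

/-- **The conclusion's index is load-bearing even over genuine smooth projective varieties.**
Decoupling the dimension index of the hypothesis from that of the conclusion gives a FALSE statement
(witness: the smooth projective `0`-fold `Spec ℂ`, conclusion read with `n = 1`). [folklore] -/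
theorem abelianComplement_false_with_decoupled_index :
    ¬ ∀ ⦃n n' : ℕ⦄ ⦃X : SchemeOver ℂ⦄, IsSmoothProjective n' X →
      (∀ A : AbelianVariety ℂ, A.dim = n → A.X ≠ X) → HodgeConjectureFor n X :=
  fun h ↦ not_hodgeConjectureFor_unit le_rfl
    (h (isSmoothProjective_unit_holds ℂ) (abelianVariety_X_ne_unit le_rfl))

/-- **Degenerate slice `n = 0`.** Every smooth projective `0`-fold satisfies the conclusion outright
(extreme codimension), whether or not it is excluded as `A.X`. [cite: Deligne2000, §1] -/
theorem abelianComplement_dim_zero ⦃X : SchemeOver ℂ⦄ (hX : IsSmoothProjective 0 X) :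
    HodgeConjectureFor 0 X :=
  ⟨nonempty_hodgeModel_holds hX, fun _ c _ _ ↦ mem_algebraicClasses_of_extreme hX (by omega) c⟩

end Summit.HodgeConjecture.HodgeConjecture.Theorems.AbelianComplement.Negative

end
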